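import Mathlib.Analysis.Real.Pi.Bounds
import Literature.Probability.HeavyTails.LogNormalTailHillTarget
import HarnessLib

/-!
# At equal mean violation a BIAS costs more acceptance than a WIDTH error:
# `2Φ(−√(m/2)) ≤ 1 − (2/π)·arctan √(m/2)` for every `m ≥ 0`

HONEST FRAMING: exact (Metropolis-corrected) sampling algorithms for lattice gauge theory;
figures of merit are autocorrelation/cost numbers at stated couplings and volumes; no
continuum-physics claim.  (SCALAR calibration rung S0-A: not a gauge result.)

Venture `LatticeQCDFlow` (cell pub-lqcd), topic `Exactness`; FANOUT row 2 (`s0-phi4`).  NEW WORK of the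
cell: a pure real-analysis comparison of the two exact one-mode acceptance curves this row typed for the
calibration battery — the Gaussian-violation (`erfc`) law `ā = 2Φ(−√(m/2))` (HMC with Gaussian `ΔH`,
`AcceptanceGaussianEnergyViolation`; a BIASED Gaussian flow, `GaussianFlowShiftAcceptance`) and the
`arctan` law `ā = 1 − (2/π)·arctan √(m/2)` (a MIS-SIZED Gaussian flow `GaussianFlowModeAcceptance`, the
Gaussian-step site update `GaussianMetropolisSiteAcceptance`, the free-field leapfrog mode
`FreeFieldHMCModeAcceptance`; the three staged in row 2's custody at the time of writing), as functions
of the common abscissa `m = ⟨ΔH⟩`.  Uses only the tree's Literature toolbox `GaussianTail` (`Φ̄' = −φ`,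
`φ' = −xφ`, `Φ̄(0) = 1/2`, `Φ̄ → 0`) and Mathlib's `arctan`.  Nothing is cited as a fact; no definition.

THE ARGUMENT (with `a = √(m/2)`; `Φ̄(a) = Φ(−a)`).  `G(a) = Φ̄(a) + (1/π)·arctan a − 1/2` vanishes at
`0` and at `+∞`, and `G' = −φ(a) + 1/(π(1+a²))` has the sign of `1/π − h(a)`, `h(a) = (1 + a²)φ(a)`;
`h' = a(1 − a²)φ(a)`, so `h` increases on `[0,1]` and decreases on `[1,∞)`, from `h(0) = φ(0) = 1/√(2π)
> 1/π` (i.e. `π > 2`).  Hence for a given `a ≥ 0`: if `h(a) ≥ 1/π` then `h ≥ 1/π` on all of `[0,a]`,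
`G` is non-increasing there and `G(a) ≤ G(0) = 0`; if `h(a) < 1/π` then `a > 1`, `h < 1/π` on
`[a,∞)`, `G` is non-decreasing there and `G(a) ≤ lim G = 0`.  No numerical constant beyond `π > 2`.

## What is proved

* §1 `stdGaussian_pdf_zero_gt_inv_pi` (`φ(0) > 1/π`), `hasDerivAt_hump` (`h' = a(1−a²)φ`),
  `hump_monotoneOn` / `hump_antitoneOn`;
* §2 `hasDerivAt_acceptGap` (`G' = 1/(π(1+a²)) − φ`), `acceptGap_zero`, `tendsto_acceptGap`;
* §3 **`stdGaussian_two_tail_le_arctan_law`**: `2Φ̄(a) ≤ 1 − (2/π)·arctan a` for `a ≥ 0`, and the strict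
  **`stdGaussian_two_tail_lt_arctan_law`** for `a > 0`; **`biasLaw_le_widthLaw`** / **`biasLaw_lt_widthLaw`**:
  `2Φ(−√(m/2)) ≤ 1 − (2/π)·arctan √(m/2)` for `m ≥ 0`, `<` for `m > 0` — at equal mean violation the
  `erfc` column is STRICTLY below the `arctan` column except at `m = 0` (both `1`).

NOT CLAIMED: anything about which law a given run follows (neither need hold at `λ > 0` or for a
trained network); many-mode statements; the size of the gap.
-/

namespace Summit.Ventures.LatticeQCDFlow.Exactness

open Real MeasureTheory ProbabilityTheory Filter Set Topology
open Literature.Probability.HeavyTails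

/-! ## §1 The hump `h(a) = (1 + a²)φ(a)` -/

/-- `φ(0) = 1/√(2π) > 1/π` (equivalently `π > 2`). -/
theorem stdGaussian_pdf_zero_gt_inv_pi : 1 / π < gaussianPDFReal 0 1 0 := by
  rw [GaussianTail.pdf_eq]
  simp only [ne_eq, OfNat.ofNat_ne_zero, not_false_eq_true, zero_pow, neg_zero, zero_div,
    Real.exp_zero, mul_one]
  have hπ : 0 < π := Real.pi_pos
  have h2 : Real.sqrt (2 * π) < π := by
    rw [Real.sqrt_lt' hπ]
    nlinarith [Real.pi_gt_d2]
  rw [one_div]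
  exact inv_strictAnti₀ (Real.sqrt_pos.mpr (by positivity)) h2

/-- `h' = a(1 − a²)φ(a)`. -/
theorem hasDerivAt_hump (a : ℝ) :
    HasDerivAt (fun x : ℝ => (1 + x ^ 2) * gaussianPDFReal 0 1 x)
      (a * (1 - a ^ 2) * gaussianPDFReal 0 1 a) a := by
  have h1 : HasDerivAt (fun x : ℝ => 1 + x ^ 2) (2 * a) a := by
    have := (hasDerivAt_pow 2 a).const_add 1
    refine this.congr_deriv ?_
    simp only [Nat.cast_ofNat]
    ring
  refine (h1.mul (GaussianTail.hasDerivAt_pdf a)).congr_deriv ?_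
  ring

/-- `h` is non-decreasing on `[0, 1]`. -/
theorem hump_monotoneOn :
    MonotoneOn (fun x : ℝ => (1 + x ^ 2) * gaussianPDFReal 0 1 x) (Icc 0 1) := by
  refine monotoneOn_of_deriv_nonneg (convex_Icc 0 1)
    (fun x _ => (hasDerivAt_hump x).continuousAt.continuousWithinAt)
    (fun x _ => (hasDerivAt_hump x).differentiableAt.differentiableWithinAt) ?_
  rw [interior_Icc]
  intro x hx
  rw [(hasDerivAt_hump x).deriv]
  have h1 : 0 ≤ 1 - x ^ 2 := by nlinarith [hx.1, hx.2]
  exact mul_nonneg (mul_nonneg hx.1.le h1) (GaussianTail.pdf_pos x).le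

/-- `h` is non-increasing on `[1, ∞)`. -/
theorem hump_antitoneOn :
    AntitoneOn (fun x : ℝ => (1 + x ^ 2) * gaussianPDFReal 0 1 x) (Ici 1) := by
  refine antitoneOn_of_deriv_nonpos (convex_Ici 1)
    (fun x _ => (hasDerivAt_hump x).continuousAt.continuousWithinAt)
    (fun x _ => (hasDerivAt_hump x).differentiableAt.differentiableWithinAt) ?_
  rw [interior_Ici]
  intro x hx
  rw [(hasDerivAt_hump x).deriv]
  have hx1 : 1 < x := hx
  have h1 : 0 ≤ x ^ 2 - 1 := by nlinarith
  have h2 : 0 ≤ x * gaussianPDFReal 0 1 x := mul_nonneg (by linarith) (GaussianTail.pdf_pos x).le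
  nlinarith [mul_nonneg h2 h1]

/-! ## §2 The gap `G(a) = Φ̄(a) + (1/π)·arctan a − 1/2` -/

/-- `G' = 1/(π(1+a²)) − φ(a)`. -/
theorem hasDerivAt_acceptGap (a : ℝ) :
    HasDerivAt (fun x : ℝ => (gaussianReal 0 1).real (Ioi x) + 1 / π * Real.arctan x - 1 / 2)
      (1 / π * (1 / (1 + a ^ 2)) - gaussianPDFReal 0 1 a) a := by
  have h := ((GaussianTail.hasDerivAt_tail a).add ((Real.hasDerivAt_arctan a).const_mul (1 / π))).sub_const
    (1 / 2 : ℝ)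
  refine h.congr_deriv ?_
  ring

/-- `G(0) = 0` (`Φ̄(0) = 1/2`). -/
theorem acceptGap_zero : (gaussianReal 0 1).real (Ioi (0 : ℝ)) + 1 / π * Real.arctan 0 - 1 / 2 = 0 := by
  rw [GaussianTail.tail_zero, Real.arctan_zero]; ring

/-- `G → 0` at `+∞` (`Φ̄ → 0`, `arctan → π/2`). -/
theorem tendsto_acceptGap :
    Tendsto (fun x : ℝ => (gaussianReal 0 1).real (Ioi x) + 1 / π * Real.arctan x - 1 / 2) atTop (𝓝 0) := by
  have h1 := GaussianTail.tendsto_tail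
  have h2 : Tendsto (fun x : ℝ => 1 / π * Real.arctan x) atTop (𝓝 (1 / π * (π / 2))) :=
    (tendsto_nhds_of_tendsto_nhdsWithin Real.tendsto_arctan_atTop).const_mul _
  have h := (h1.add h2).sub_const (1 / 2 : ℝ)
  have hπ : π ≠ 0 := Real.pi_pos.ne'
  rw [show (0 : ℝ) + 1 / π * (π / 2) - 1 / 2 = 0 by field_simp; ring] at h
  exact h

/-! ## §3 The comparison -/

/-- **`2Φ̄(a) ≤ 1 − (2/π)·arctan a` for `a ≥ 0`.** -/
theorem stdGaussian_two_tail_le_arctan_law {a : ℝ} (ha : 0 ≤ a) :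
    2 * (gaussianReal 0 1).real (Ioi a) ≤ 1 - 2 / π * Real.arctan a := by
  -- it suffices that `G(a) ≤ 0`
  set G : ℝ → ℝ := fun x => (gaussianReal 0 1).real (Ioi x) + 1 / π * Real.arctan x - 1 / 2 with hG
  suffices hGa : G a ≤ 0 by
    have : G a = (gaussianReal 0 1).real (Ioi a) + 1 / π * Real.arctan a - 1 / 2 := rfl
    rw [this] at hGa
    have hπ : 0 < π := Real.pi_pos
    have e : 1 - 2 / π * Real.arctan a - 2 * (gaussianReal 0 1).real (Ioi a)
        = -2 * ((gaussianReal 0 1).real (Ioi a) + 1 / π * Real.arctan a - 1 / 2) := by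
      field_simp
      ring
    nlinarith [e]
  set h : ℝ → ℝ := fun x => (1 + x ^ 2) * gaussianPDFReal 0 1 x with hh
  have hderiv : ∀ x, HasDerivAt G (1 / π * (1 / (1 + x ^ 2)) - gaussianPDFReal 0 1 x) x :=
    fun x => hasDerivAt_acceptGap x
  -- the sign of `G'` is the sign of `1/π − h`
  have hsign : ∀ x, (1 / π * (1 / (1 + x ^ 2)) - gaussianPDFReal 0 1 x ≤ 0 ↔ 1 / π ≤ h x) := by
    intro x
    have hx2 : 0 < 1 + x ^ 2 := by positivity
    simp only [hh]
    rw [sub_nonpos, show 1 / π * (1 / (1 + x ^ 2)) = (1 / π) / (1 + x ^ 2) by ring, div_le_iff₀ hx2,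
      mul_comm]
  have h0 : 1 / π < h 0 := by
    simp only [hh]
    rw [show (1 + (0 : ℝ) ^ 2) * gaussianPDFReal 0 1 0 = gaussianPDFReal 0 1 0 by ring]
    exact stdGaussian_pdf_zero_gt_inv_pi
  by_cases hcase : 1 / π ≤ h a
  · -- `h ≥ 1/π` on `[0, a]`, so `G` is non-increasing there
    have hmono : AntitoneOn G (Icc 0 a) := by
      refine antitoneOn_of_deriv_nonpos (convex_Icc 0 a)
        (fun x _ => (hderiv x).continuousAt.continuousWithinAt)
        (fun x _ => (hderiv x).differentiableAt.differentiableWithinAt) ?_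
      intro x hx
      rw [interior_Icc] at hx
      rw [(hderiv x).deriv, hsign]
      by_cases hx1 : x ≤ 1
      · exact h0.le.trans (hump_monotoneOn ⟨le_rfl, zero_le_one⟩ ⟨hx.1.le, hx1⟩ hx.1.le)
      · push Not at hx1
        exact hcase.trans (hump_antitoneOn (show x ∈ Ici (1 : ℝ) from hx1.le)
          (show a ∈ Ici (1 : ℝ) from hx1.le.trans hx.2.le) hx.2.le)
    have h00 : G 0 = 0 := acceptGap_zero
    exact (hmono ⟨le_rfl, ha⟩ ⟨ha, le_rfl⟩ ha).trans_eq h00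
  · -- `h(a) < 1/π`: then `a > 1`, `h < 1/π` on `[a, ∞)`, `G` non-decreasing there with limit `0`
    push Not at hcase
    have ha1 : 1 < a := by
      by_contra hle
      push Not at hle
      have := hump_monotoneOn ⟨le_rfl, zero_le_one⟩ ⟨ha, hle⟩ ha
      exact absurd (h0.trans_le this) (not_lt.mpr hcase.le)
    have hmono : MonotoneOn G (Ici a) := by
      refine monotoneOn_of_deriv_nonneg (convex_Ici a)
        (fun x _ => (hderiv x).continuousAt.continuousWithinAt)
        (fun x _ => (hderiv x).differentiableAt.differentiableWithinAt) ?_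
      intro x hx
      rw [interior_Ici] at hx
      rw [(hderiv x).deriv]
      have hxa : a < x := hx
      have hhx : h x ≤ h a := hump_antitoneOn ha1.le (ha1.le.trans hxa.le) hxa.le
      have : ¬ (1 / π ≤ h x) := not_le.mpr (hhx.trans_lt hcase)
      rw [← hsign] at this
      exact (not_le.mp this).le
    refine ge_of_tendsto tendsto_acceptGap ?_
    filter_upwards [eventually_ge_atTop a] with x hx
    exact hmono (self_mem_Ici) (show x ∈ Ici a from hx) hx

/-- Strict form for `a > 0`: **`2Φ̄(a) < 1 − (2/π)·arctan a`**.  (On `[0, min(a,1)]` the hump stays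
above `1/π`, so `G` is strictly decreasing there; if `h(a) < 1/π` instead, `G` is strictly increasing on
`[a, ∞)` and `G(a) < G(a+1) ≤ 0`.) -/
theorem stdGaussian_two_tail_lt_arctan_law {a : ℝ} (ha : 0 < a) :
    2 * (gaussianReal 0 1).real (Ioi a) < 1 - 2 / π * Real.arctan a := by
  set G : ℝ → ℝ := fun x => (gaussianReal 0 1).real (Ioi x) + 1 / π * Real.arctan x - 1 / 2 with hG
  have hGle : ∀ x, 0 ≤ x → G x ≤ 0 := by
    intro x hx
    have h := stdGaussian_two_tail_le_arctan_law hx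
    have hπ : 0 < π := Real.pi_pos
    have e : G x = -(1 / 2) * (1 - 2 / π * Real.arctan x - 2 * (gaussianReal 0 1).real (Ioi x)) := by
      simp only [hG]
      field_simp
      ring
    rw [e]
    nlinarith
  suffices hGa : G a < 0 by
    have e : 1 - 2 / π * Real.arctan a - 2 * (gaussianReal 0 1).real (Ioi a) = -2 * G a := by
      simp only [hG]
      field_simp
      ring
    nlinarith [e]
  have hderiv : ∀ x, HasDerivAt G (1 / π * (1 / (1 + x ^ 2)) - gaussianPDFReal 0 1 x) x :=
    fun x => hasDerivAt_acceptGap x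
  have h00 : G 0 = 0 := acceptGap_zero
  have hφ0 : 1 / π < gaussianPDFReal 0 1 0 := stdGaussian_pdf_zero_gt_inv_pi
  -- strict sign of `G'` from the hump
  have hneg : ∀ x, 1 / π < (1 + x ^ 2) * gaussianPDFReal 0 1 x →
      1 / π * (1 / (1 + x ^ 2)) - gaussianPDFReal 0 1 x < 0 := by
    intro x hx
    have hx2 : 0 < 1 + x ^ 2 := by positivity
    rw [sub_neg, show 1 / π * (1 / (1 + x ^ 2)) = (1 / π) / (1 + x ^ 2) by ring, div_lt_iff₀ hx2, mul_comm]
    exact hx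
  have hpos : ∀ x, (1 + x ^ 2) * gaussianPDFReal 0 1 x < 1 / π →
      0 < 1 / π * (1 / (1 + x ^ 2)) - gaussianPDFReal 0 1 x := by
    intro x hx
    have hx2 : 0 < 1 + x ^ 2 := by positivity
    rw [sub_pos, show 1 / π * (1 / (1 + x ^ 2)) = (1 / π) / (1 + x ^ 2) by ring, lt_div_iff₀ hx2, mul_comm]
    exact hx
  by_cases hcase : 1 / π ≤ (1 + a ^ 2) * gaussianPDFReal 0 1 a
  · -- strictly decreasing on `[0, min a 1]`, non-increasing on `[0, a]`
    set b : ℝ := min a 1 with hb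
    have hb0 : 0 < b := lt_min ha one_pos
    have hba : b ≤ a := min_le_left _ _
    have hb1 : b ≤ 1 := min_le_right _ _
    have hstrict : StrictAntiOn G (Icc 0 b) := by
      refine strictAntiOn_of_deriv_neg (convex_Icc 0 b)
        (fun x _ => (hderiv x).continuousAt.continuousWithinAt) ?_
      intro x hx
      rw [interior_Icc] at hx
      rw [(hderiv x).deriv]
      refine hneg x (hφ0.trans_le ?_)
      have hm := hump_monotoneOn ⟨le_rfl, zero_le_one⟩ ⟨hx.1.le, hx.2.le.trans hb1⟩ hx.1.le
      simpa using hm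
    have h1 : G b < G 0 := hstrict ⟨le_rfl, hb0.le⟩ ⟨hb0.le, le_rfl⟩ hb0
    -- non-strict monotonicity on `[0, a]` as in the main theorem
    have hmono : AntitoneOn G (Icc 0 a) := by
      refine antitoneOn_of_deriv_nonpos (convex_Icc 0 a)
        (fun x _ => (hderiv x).continuousAt.continuousWithinAt)
        (fun x _ => (hderiv x).differentiableAt.differentiableWithinAt) ?_
      intro x hx
      rw [interior_Icc] at hx
      rw [(hderiv x).deriv]
      by_cases hx1 : x ≤ 1
      · have hm := hump_monotoneOn ⟨le_rfl, zero_le_one⟩ ⟨hx.1.le, hx1⟩ hx.1.le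
        exact (hneg x (hφ0.trans_le (by simpa using hm))).le
      · push Not at hx1
        have hm : (1 + a ^ 2) * gaussianPDFReal 0 1 a ≤ (1 + x ^ 2) * gaussianPDFReal 0 1 x :=
          hump_antitoneOn (show x ∈ Ici (1 : ℝ) from hx1.le)
            (show a ∈ Ici (1 : ℝ) from hx1.le.trans hx.2.le) hx.2.le
        have hx2 : 0 < 1 + x ^ 2 := by positivity
        rw [sub_nonpos, show 1 / π * (1 / (1 + x ^ 2)) = (1 / π) / (1 + x ^ 2) by ring, div_le_iff₀ hx2,
          mul_comm]
        exact hcase.trans hm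
    have h2 : G a ≤ G b := hmono ⟨hb0.le, hba⟩ ⟨ha.le, le_rfl⟩ hba
    linarith
  · -- strictly increasing on `[a, a + 1]`, and `G(a+1) ≤ 0`
    push Not at hcase
    have ha1 : 1 < a := by
      by_contra hle
      push Not at hle
      have hm := hump_monotoneOn ⟨le_rfl, zero_le_one⟩ ⟨ha.le, hle⟩ ha.le
      have : 1 / π < (1 + a ^ 2) * gaussianPDFReal 0 1 a := hφ0.trans_le (by simpa using hm)
      linarith
    have hstrict : StrictMonoOn G (Icc a (a + 1)) := by
      refine strictMonoOn_of_deriv_pos (convex_Icc a (a + 1))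
        (fun x _ => (hderiv x).continuousAt.continuousWithinAt) ?_
      intro x hx
      rw [interior_Icc] at hx
      rw [(hderiv x).deriv]
      refine hpos x (lt_of_le_of_lt ?_ hcase)
      exact hump_antitoneOn (show a ∈ Ici (1 : ℝ) from ha1.le)
        (show x ∈ Ici (1 : ℝ) from ha1.le.trans hx.1.le) hx.1.le
    have h1 : G a < G (a + 1) := hstrict ⟨le_rfl, by linarith⟩ ⟨by linarith, le_rfl⟩ (by linarith)
    have h2 : G (a + 1) ≤ 0 := hGle (a + 1) (by linarith)
    linarith

/-- **AT EQUAL MEAN VIOLATION, BIAS ≤ WIDTH**: for every `m ≥ 0`,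
`2Φ(−√(m/2)) ≤ 1 − (2/π)·arctan √(m/2)` — the Gaussian-violation (`erfc`) acceptance law is never above
the `arctan` law on the common abscissa `m = ⟨ΔH⟩`. -/
theorem biasLaw_le_widthLaw {m : ℝ} (hm : 0 ≤ m) :
    2 * (gaussianReal (0 : ℝ) 1).real (Iic (-Real.sqrt (m / 2)))
      ≤ 1 - 2 / π * Real.arctan (Real.sqrt (m / 2)) := by
  have _ := hm
  -- `Φ(−a) = Φ̄(a)` by reflection (and no atom at `a`)
  have hsymm : (gaussianReal (0 : ℝ) 1).map (fun y => -y) = gaussianReal 0 1 := by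
    rw [gaussianReal_map_neg, neg_zero]
  have hrefl : (gaussianReal (0 : ℝ) 1).real (Iic (-Real.sqrt (m / 2)))
      = (gaussianReal (0 : ℝ) 1).real (Ioi (Real.sqrt (m / 2))) := by
    conv_lhs => rw [← hsymm]
    rw [map_measureReal_apply measurable_neg measurableSet_Iic]
    have hpre : (fun y : ℝ => -y) ⁻¹' Iic (-Real.sqrt (m / 2)) = Ici (Real.sqrt (m / 2)) := by
      ext y
      simp
    rw [hpre]
    haveI := nullSingletonClass_gaussianReal (μ := (0 : ℝ)) one_ne_zero
    exact measureReal_congr Ioi_ae_eq_Ici.symm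
  rw [hrefl]
  exact stdGaussian_two_tail_le_arctan_law (Real.sqrt_nonneg _)

/-- Strict form for `m > 0`: **`2Φ(−√(m/2)) < 1 − (2/π)·arctan √(m/2)`**. -/
theorem biasLaw_lt_widthLaw {m : ℝ} (hm : 0 < m) :
    2 * (gaussianReal (0 : ℝ) 1).real (Iic (-Real.sqrt (m / 2)))
      < 1 - 2 / π * Real.arctan (Real.sqrt (m / 2)) := by
  have hsymm : (gaussianReal (0 : ℝ) 1).map (fun y => -y) = gaussianReal 0 1 := by
    rw [gaussianReal_map_neg, neg_zero]
  have hrefl : (gaussianReal (0 : ℝ) 1).real (Iic (-Real.sqrt (m / 2)))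
      = (gaussianReal (0 : ℝ) 1).real (Ioi (Real.sqrt (m / 2))) := by
    conv_lhs => rw [← hsymm]
    rw [map_measureReal_apply measurable_neg measurableSet_Iic]
    have hpre : (fun y : ℝ => -y) ⁻¹' Iic (-Real.sqrt (m / 2)) = Ici (Real.sqrt (m / 2)) := by
      ext y
      simp
    rw [hpre]
    haveI := nullSingletonClass_gaussianReal (μ := (0 : ℝ)) one_ne_zero
    exact measureReal_congr Ioi_ae_eq_Ici.symm
  rw [hrefl]
  exact stdGaussian_two_tail_lt_arctan_law (Real.sqrt_pos.mpr (by positivity))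

end Summit.Ventures.LatticeQCDFlow.Exactness
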